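import Summits.KontsevichZagierPeriods.KontsevichZagierPeriods.Theorems.IsogenyCertificatesXMapKernelStubHuberWustholzSplitting
import Literature.NumberTheory.EllipticCurves.LatticeMultiplierIndex

/-!
# `XMapKernel`, line `isogeny-orbit-collapse` — stub **R-b3**, auxiliary file

The imaginary quadratic order `ℚ + ℚτ` of a CM lattice, and a norm argument.

Support file for the crux `IsogenyCertificates.XMapKernel` (stmt-KontsevichZagierPeriods-10663),
line `isogeny-orbit-collapse`, stub `stub_cmClass` (R-b3, the CM class); this auxiliary file
carries the field-theoretic half of R-b3 and its registered main theorem is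
`stub_cmClass_powRational`. Setting: a lattice `Λ` WITH complex multiplication
(`PeriodPair.HasCM`: a multiplier `τΛ ⊆ Λ`, `τ ∉ ℤ`).

1. *The CM multiplier* (`exists_cm_multiplier`). A non-integer multiplier `τ` is non-real
   (a real multiplier is an integer by the `ℝ`-independence of `ω₁, ω₂`) and satisfies
   `τ² = pτ + q` with `p, q ∈ ℤ` (trace and determinant of `τ` on `Λ = ℤω₁ ⊕ ℤω₂`,
   `PeriodPair.sq_sub_trace_mul_add_det_eq_zero`). The `ℚ`-space `K = ℚ + ℚτ` is then closed
   under products (`qtau_mul`) and under every field automorphism `σ` of `ℂ`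
   (`ringEquiv_apply_tau`: `σ(τ) ∈ {τ, p − τ}`, the two roots of `X² − pX − q`), its real
   elements are rational (`im (a + bτ) = b·im τ`), and `τ` is algebraic (`isAlgebraic_tau`).
2. *The span of a CM lattice* (`lattice_subset_qtau_mul`). If `τΛ ⊆ Λ` with `τ ∉ ℝ` and
   `u ∈ Λ ∩ ℝ`, `u ≠ 0`, then `Λ ⊆ K·u`: `u, τu` are `ℝ`-independent lattice vectors, so
   `NΛ ⊆ ℤu + ℤτu` for some `N ≥ 1` (`exists_nat_mul_mem_of_le`).
3. *Norm argument* (`stub_cmClass_powRational`). If `ρ ≠ 0` is a real algebraic number all of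
   whose `Aut(ℂ)`-conjugates lie in `K·ρ`, then `ρ^d ∈ ℚ` for some `d ≥ 1`: with `d` the degree
   of `ρ`, every complex root of the minimal polynomial of `ρ` is a conjugate `σ(ρ)`
   (`Complex.exists_ringEquiv_apply_eq_of_aeval_minpoly_eq_zero`), so the product of the roots,
   a non-zero rational (`Splits.coeff_zero_eq_prod_roots_of_monic`), equals `κρ^d` with
   `κ ∈ K`; comparing imaginary parts, `κ ∈ ℚ`.

No definitions, no named facts. The companion file `…StubCMClass.lean` proves R-b3.

References: D. A. Cox, *Primes of the form x² + ny²* (2013), Thm. 10.14, §10.C;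
J. H. Silverman, *Advanced Topics in the Arithmetic of Elliptic Curves* (1994), Prop. II.1.2.
-/

noncomputable section

namespace Summit.KontsevichZagierPeriods.IsogenyCertificates.XMapKernelStubs.CMClass

open Complex Polynomial Literature.FieldTheory.AlgClosed

/-! ## §1 The CM multiplier and the `ℚ`-space `ℚ + ℚτ` -/

/-- **The CM multiplier.** A lattice with complex multiplication has a NON-REAL multiplier
`τΛ ⊆ Λ` satisfying `τ² = pτ + q` with `p, q ∈ ℤ`: a non-integer multiplier (definition of
`PeriodPair.HasCM`) is non-real, since a real multiplier `τ` with `τω₁ = aω₁ + bω₂` has `b = 0`,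
`τ = a` by the `ℝ`-independence of `ω₁, ω₂`; the quadratic relation is
`PeriodPair.sq_sub_trace_mul_add_det_eq_zero`. [cite: Cox2013, Thm. 10.14] -/
theorem exists_cm_multiplier {L : PeriodPair} (h : L.HasCM) :
    ∃ (τ : ℂ) (p q : ℤ), τ.im ≠ 0 ∧ (∀ l ∈ L.lattice, τ * l ∈ L.lattice) ∧
      τ ^ 2 = (p : ℂ) * τ + (q : ℂ) := by
  obtain ⟨τ, hτZ, hτ⟩ := h
  obtain ⟨a, b, hab⟩ := PeriodPair.mem_lattice.1 (hτ _ L.ω₁_mem_lattice)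
  obtain ⟨c, d, hcd⟩ := PeriodPair.mem_lattice.1 (hτ _ L.ω₂_mem_lattice)
  have hquad := PeriodPair.sq_sub_trace_mul_add_det_eq_zero hab.symm hcd.symm
  refine ⟨τ, a + d, -(a * d - b * c), ?_, hτ, ?_⟩
  · intro him
    have hre : (τ.re : ℂ) = τ := Complex.ext (by simp) (by simp [him])
    have e₁ : ((τ.re - a : ℝ) : ℂ) * L.ω₁ + ((-b : ℝ) : ℂ) * L.ω₂ = 0 := by
      push_cast
      rw [hre]
      linear_combination -hab
    obtain ⟨ha, -⟩ := L.eq_zero_of_real_combination e₁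
    refine hτZ a ?_
    rw [← hre]
    exact_mod_cast sub_eq_zero.1 ha
  · push_cast
    linear_combination hquad

/-- `ℚ + ℚτ` is closed under products when `τ² = pτ + q`. [folklore] -/
theorem qtau_mul {τ : ℂ} {p q : ℤ} (hquad : τ ^ 2 = (p : ℂ) * τ + (q : ℂ)) (a b c d : ℚ) :
    ∃ a' b' : ℚ, ((a : ℂ) + b * τ) * (c + d * τ) = a' + b' * τ :=
  ⟨a * c + b * d * q, a * d + b * c + b * d * p, by
    push_cast
    linear_combination ((b : ℂ) * d) * hquad⟩

/-- A field automorphism of `ℂ` maps `τ` to one of the two roots `τ`, `p − τ` of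
`X² − pX − q`. [folklore] -/
theorem ringEquiv_apply_tau {τ : ℂ} {p q : ℤ} (hquad : τ ^ 2 = (p : ℂ) * τ + (q : ℂ))
    (σ : ℂ ≃+* ℂ) : σ τ = τ ∨ σ τ = p - τ := by
  have h1 : (σ τ) ^ 2 = (p : ℂ) * σ τ + (q : ℂ) := by
    have := congrArg σ hquad
    simpa only [map_pow, map_add, map_mul, map_intCast] using this
  have h2 : (σ τ - τ) * (σ τ - (p - τ)) = 0 := by linear_combination h1 - hquad
  rcases mul_eq_zero.1 h2 with h | h
  · left; linear_combination h
  · right; linear_combination h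

/-- `ℚ + ℚτ` is stable under every field automorphism of `ℂ`. [folklore] -/
theorem ringEquiv_apply_qtau {τ : ℂ} {p q : ℤ} (hquad : τ ^ 2 = (p : ℂ) * τ + (q : ℂ))
    (σ : ℂ ≃+* ℂ) (a b : ℚ) : ∃ a' b' : ℚ, σ ((a : ℂ) + b * τ) = a' + b' * τ := by
  rw [map_add, map_mul, map_ratCast, map_ratCast]
  rcases ringEquiv_apply_tau hquad σ with h | h
  · exact ⟨a, b, by rw [h]⟩
  · exact ⟨a + b * p, -b, by rw [h]; push_cast; ring⟩

/-- `τ` with `τ² = pτ + q` (`p, q ∈ ℤ`) is algebraic. [folklore] -/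
theorem isAlgebraic_tau {τ : ℂ} {p q : ℤ} (hquad : τ ^ 2 = (p : ℂ) * τ + (q : ℂ)) :
    IsAlgebraic ℚ τ := by
  refine ⟨X ^ 2 - (C (p : ℚ) * X + C (q : ℚ)), (monic_X_pow_sub degree_linear_lt).ne_zero, ?_⟩
  simp only [map_sub, map_add, map_mul, map_pow, aeval_X, aeval_C, eq_ratCast]
  push_cast
  linear_combination hquad

/-! ## §2 A CM lattice spans `(ℚ + ℚτ)·u` over `ℚ` -/

/-- `u` and `τu` are `ℝ`-independent for `u ∈ ℝ ∖ {0}` and `τ ∉ ℝ`. [folklore] -/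
theorem linearIndependent_pair {τ : ℂ} (hτ : τ.im ≠ 0) {u : ℝ} (hu : u ≠ 0) :
    LinearIndependent ℝ ![(u : ℂ), τ * u] := by
  refine LinearIndependent.pair_iff.2 fun s t h => ?_
  have him : t * (τ.im * u) = 0 := by
    have := congrArg Complex.im h
    simpa using this
  have ht : t = 0 := by
    rcases mul_eq_zero.1 him with h0 | h0
    · exact h0
    · exact absurd h0 (mul_ne_zero hτ hu)
  have hre : s * u = 0 := by
    have := congrArg Complex.re h
    rw [ht] at this
    simpa using this
  exact ⟨(mul_eq_zero.1 hre).resolve_right hu, ht⟩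

/-- An integer multiple of a lattice vector is a lattice vector. [folklore] -/
theorem intCast_mul_mem {L : PeriodPair} (z : ℤ) {x : ℂ} (hx : x ∈ L.lattice) :
    (z : ℂ) * x ∈ L.lattice := by
  rw [← zsmul_eq_mul]
  exact L.lattice.smul_mem z hx

/-- **The span of a CM lattice.** If `τΛ ⊆ Λ` with `τ ∉ ℝ` and `u ∈ Λ` is a non-zero real
lattice vector, then `Λ ⊆ (ℚ + ℚτ)·u`: the `ℝ`-independent lattice vectors `u, τu` span a
sub-lattice of finite index, `NΛ ⊆ ℤu + ℤτu` (`exists_nat_mul_mem_of_le`). [folklore] -/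
theorem lattice_subset_qtau_mul {L : PeriodPair} {τ : ℂ} (hτ : τ.im ≠ 0)
    (hτL : ∀ l ∈ L.lattice, τ * l ∈ L.lattice) {u : ℝ} (hu : u ≠ 0)
    (huL : (u : ℂ) ∈ L.lattice) :
    ∀ l ∈ L.lattice, ∃ a b : ℚ, l = ((a : ℂ) + b * τ) * u := by
  let P : PeriodPair := ⟨u, τ * u, linearIndependent_pair hτ hu⟩
  have hle : P.lattice ≤ L.lattice := by
    refine Submodule.span_le.2 ?_
    rintro x (rfl | rfl)
    · exact huL
    · exact hτL _ huL
  obtain ⟨N, hN, hNL⟩ := HuberWustholzSplitting.exists_nat_mul_mem_of_le hle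
  have hNc : (N : ℂ) ≠ 0 := by exact_mod_cast hN
  intro l hl
  obtain ⟨m, n, hmn⟩ := PeriodPair.mem_lattice.1 (hNL l hl)
  have hmn' : (m : ℂ) * u + n * (τ * u) = N * l := hmn
  refine ⟨m / N, n / N, ?_⟩
  push_cast
  field_simp
  linear_combination -hmn'

/-- A rational combination of two lattice vectors has bounded denominator: `D·(ae₁ + be₂) ∈ Λ`
for `D = den(a)·den(b)`. [folklore] -/
theorem exists_nat_mul_qcomb_mem {L : PeriodPair} {e₁ e₂ : ℂ} (h₁ : e₁ ∈ L.lattice)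
    (h₂ : e₂ ∈ L.lattice) (a b : ℚ) :
    ∃ D : ℕ, D ≠ 0 ∧ (D : ℂ) * ((a : ℂ) * e₁ + b * e₂) ∈ L.lattice := by
  refine ⟨a.den * b.den, mul_ne_zero a.den_nz b.den_nz, ?_⟩
  have ha : ((a.den : ℚ) * a : ℚ) = a.num := Rat.den_mul_eq_num a
  have hb : ((b.den : ℚ) * b : ℚ) = b.num := Rat.den_mul_eq_num b
  have ha' : (a.den : ℂ) * (a : ℂ) = (a.num : ℂ) := by exact_mod_cast congrArg ((↑) : ℚ → ℂ) ha
  have hb' : (b.den : ℂ) * (b : ℂ) = (b.num : ℂ) := by exact_mod_cast congrArg ((↑) : ℚ → ℂ) hb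
  have e : ((a.den * b.den : ℕ) : ℂ) * ((a : ℂ) * e₁ + b * e₂)
      = ((b.den * a.num : ℤ) : ℂ) * e₁ + ((a.den * b.num : ℤ) : ℂ) * e₂ := by
    push_cast
    linear_combination (b.den : ℂ) * e₁ * ha' + (a.den : ℂ) * e₂ * hb'
  rw [e]
  exact add_mem (intCast_mul_mem _ h₁) (intCast_mul_mem _ h₂)

/-! ## §3 The norm argument: conjugates in `(ℚ + ℚτ)·ρ` force `ρ^d ∈ ℚ` -/

/-- Products over a multiset of elements of `(ℚ + ℚτ)·ρ` lie in `(ℚ + ℚτ)·ρ^{card}`.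
[folklore] -/
theorem multiset_prod_qtau {τ : ℂ} {p q : ℤ} (hquad : τ ^ 2 = (p : ℂ) * τ + (q : ℂ)) (ρ : ℂ)
    (t : Multiset ℂ) (ht : ∀ y ∈ t, ∃ a b : ℚ, y = ((a : ℂ) + b * τ) * ρ) :
    ∃ a b : ℚ, t.prod = ((a : ℂ) + b * τ) * ρ ^ (Multiset.card t) := by
  induction t using Multiset.induction_on with
  | empty => exact ⟨1, 0, by simp⟩
  | cons y t ih =>
    obtain ⟨a, b, hab⟩ := ht y (Multiset.mem_cons_self y t)
    obtain ⟨c, d, hcd⟩ := ih fun z hz => ht z (Multiset.mem_cons_of_mem hz)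
    obtain ⟨a', b', hmul⟩ := qtau_mul hquad a b c d
    refine ⟨a', b', ?_⟩
    rw [Multiset.prod_cons, Multiset.card_cons, hab, hcd, pow_succ]
    linear_combination ρ * ρ ^ (Multiset.card t) * hmul

/-- **Norm argument.** Let `τ ∉ ℝ` with `τ² = pτ + q` (`p, q ∈ ℤ`) and let `ρ ≠ 0` be a real
algebraic number all of whose `Aut(ℂ)`-conjugates lie in `(ℚ + ℚτ)·ρ`. Then `ρ^d ∈ ℚ` for some
`d ≥ 1` (the degree of `ρ`): every complex root of the minimal polynomial of `ρ` is a conjugate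
`σ(ρ)` (`Complex.exists_ringEquiv_apply_eq_of_aeval_minpoly_eq_zero`), so the product of the
roots — up to sign the constant coefficient, a non-zero rational
(`Splits.coeff_zero_eq_prod_roots_of_monic`, `minpoly.coeff_zero_ne_zero`) — is `κρ^d` with
`κ ∈ ℚ + ℚτ` (`multiset_prod_qtau`), and `κ` is real, hence rational. This is the support
file's registered main theorem (helper of stub R-b3, `stub_cmClass`).
[cite: Cox2013, §10.C proof of Thm. 10.23] -/
theorem stub_cmClass_powRational : ∀ (τ : ℂ) (p q : ℤ), τ.im ≠ 0 → τ ^ 2 = (p : ℂ) * τ + (q : ℂ) → ∀ (ρ : ℝ), ρ ≠ 0 → IsAlgebraic ℚ (ρ : ℂ) → (∀ σ : ℂ ≃+* ℂ, ∃ a b : ℚ, σ (ρ : ℂ) = ((a : ℂ) + b * τ) * ρ) → ∃ d : ℕ, 0 < d ∧ ∃ r : ℚ, ρ ^ d = (r : ℝ) := by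
  intro τ p q hτ hquad ρ hρ halg hconj
  classical
  have hint : IsIntegral ℚ (ρ : ℂ) := halg.isIntegral
  have hρc : (ρ : ℂ) ≠ 0 := by exact_mod_cast hρ
  -- every complex root of the minimal polynomial is a conjugate, hence in `(ℚ + ℚτ)ρ`
  have hroot : ∀ y ∈ (minpoly ℚ (ρ : ℂ)).aroots ℂ, ∃ a b : ℚ, y = ((a : ℂ) + b * τ) * ρ := by
    intro y hy
    rw [mem_aroots] at hy
    obtain ⟨σ, hσ⟩ := Complex.exists_ringEquiv_apply_eq_of_aeval_minpoly_eq_zero hint hy.2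
    obtain ⟨a, b, hab⟩ := hconj σ
    exact ⟨a, b, by rw [← hσ, hab]⟩
  obtain ⟨a, b, hab⟩ := multiset_prod_qtau hquad (ρ : ℂ) _ hroot
  -- the product of the roots is `± coeff 0`, a non-zero rational
  have hsplit : ((minpoly ℚ (ρ : ℂ)).map (algebraMap ℚ ℂ)).Splits := IsAlgClosed.splits _
  have hmonic : ((minpoly ℚ (ρ : ℂ)).map (algebraMap ℚ ℂ)).Monic := (minpoly.monic hint).map _
  have hcoeff := hsplit.coeff_zero_eq_prod_roots_of_monic hmonic
  rw [coeff_map, hsplit.natDegree_eq_card_roots, ← aroots_def, hab, eq_ratCast] at hcoeff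
  have hc₀ : (minpoly ℚ (ρ : ℂ)).coeff 0 ≠ 0 := minpoly.coeff_zero_ne_zero hint hρc
  set d : ℕ := Multiset.card ((minpoly ℚ (ρ : ℂ)).aroots ℂ) with hd
  have hdpos : 0 < d := by
    have h1 : ((minpoly ℚ (ρ : ℂ)).map (algebraMap ℚ ℂ)).natDegree = d := by
      rw [hd, aroots_def]
      exact hsplit.natDegree_eq_card_roots
    rw [← h1, natDegree_map]
    exact minpoly.natDegree_pos hint
  obtain ⟨ε, hε, hε'⟩ : ∃ ε : ℚ, ε ≠ 0 ∧ (ε : ℂ) = (-1 : ℂ) ^ d := by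
    rcases neg_one_pow_eq_or ℂ d with h | h
    · exact ⟨1, one_ne_zero, by rw [h]; simp⟩
    · exact ⟨-1, by norm_num, by rw [h]; simp⟩
  rw [← hε'] at hcoeff
  -- `(a + bτ) ρ^d = c₀/ε`, a rational; imaginary parts give `b = 0`
  have hεc : (ε : ℂ) ≠ 0 := by exact_mod_cast hε
  have E : ((a : ℂ) + b * τ) * ((ρ ^ d : ℝ) : ℂ) =
      (((minpoly ℚ (ρ : ℂ)).coeff 0 / ε : ℚ) : ℂ) := by
    push_cast
    field_simp
    linear_combination -hcoeff
  have hρd : ρ ^ d ≠ 0 := pow_ne_zero d hρ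
  have hκim : ((a : ℂ) + b * τ).im = (b : ℝ) * τ.im := by simp
  have him : (b : ℝ) * τ.im * ρ ^ d = 0 := by
    have h1 := congrArg Complex.im E
    rwa [Complex.mul_im, Complex.ofReal_re, Complex.ofReal_im, mul_zero, zero_add, hκim,
      Complex.ratCast_im] at h1
  have hb : b = 0 := by
    have : (b : ℝ) = 0 := by
      rcases mul_eq_zero.1 him with h | h
      · exact (mul_eq_zero.1 h).resolve_right hτ
      · exact absurd h hρd
    exact_mod_cast this
  rw [hb, Rat.cast_zero, zero_mul, add_zero] at E
  have ha : a ≠ 0 := by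
    rintro rfl
    rw [Rat.cast_zero, zero_mul] at E
    have : ((minpoly ℚ (ρ : ℂ)).coeff 0 / ε : ℚ) = 0 := by exact_mod_cast E.symm
    exact (div_ne_zero hc₀ hε) this
  refine ⟨d, hdpos, (minpoly ℚ (ρ : ℂ)).coeff 0 / ε / a, ?_⟩
  have E' : ((a : ℝ) * ρ ^ d : ℝ) = (((minpoly ℚ (ρ : ℂ)).coeff 0 / ε : ℚ) : ℝ) := by
    exact_mod_cast E
  have hac : (a : ℝ) ≠ 0 := by exact_mod_cast ha
  have hεr : (ε : ℝ) ≠ 0 := by exact_mod_cast hε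
  push_cast at E' ⊢
  have E'' : (a : ℝ) * ρ ^ d * ε = (minpoly ℚ (ρ : ℂ)).coeff 0 := by
    rw [E', div_mul_cancel₀ _ hεr]
  rw [eq_div_iff hac, eq_div_iff hεr]
  linear_combination E''

end Summit.KontsevichZagierPeriods.IsogenyCertificates.XMapKernelStubs.CMClass
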